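import Mathlib

/-!
# Crux `TateFamilyKernel` (stmt-KontsevichZagierPeriods-9130), line `Sketch`:
# stub `stub_tauAdicDigits` (wave 14 — uniqueness of `τ`-adic digits)

Pure one-variable polynomial algebra over a field `K`. If `τ ∈ K[X]` is non-constant and
`Σ_{j=0}^{m} a_j τ^{m-j} = 0` with every "digit" `a_j` of degree `< deg τ`, then all digits vanish.
Proof: induction on `m` (generalising the digit sequence `a`). Every term with `j < m` is divisible
by `τ`, so `τ ∣ a_m`, whence `a_m = 0` by degrees (`Polynomial.eq_zero_of_dvd_of_natDegree_lt`);
the remaining sum is `τ · Σ_{j<m} a_j τ^{m-1-j}`, and cancelling `τ ≠ 0` gives the hypothesis for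
`m - 1`. Mathlib only; no named fact, no new definition.
-/

noncomputable section

open MeasureTheory Set MvPolynomial

namespace Summit.KontsevichZagierPeriods.InverseLandau.TateFamilyKernel.Descent

/-- **Uniqueness of `τ`-adic digits.** If `Σ_{j≤m} a_j τ^{m−j} = 0` with all `deg a_j < deg τ`
(`τ` non-constant), then every `a_j = 0` (reduce modulo `τ`, cancel `τ`, induct). [folklore] -/
theorem stub_tauAdicDigits {K : Type*} [Field K] (τ : Polynomial K) (hτ : 0 < τ.natDegree) (m : ℕ)
    (a : ℕ → Polynomial K) (ha : ∀ j, (a j).natDegree < τ.natDegree)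
    (h : ∑ j ∈ Finset.range (m + 1), a j * τ ^ (m - j) = 0) : ∀ j ≤ m, a j = 0 := by
  have hτ0 : τ ≠ 0 := Polynomial.ne_zero_of_natDegree_gt hτ
  induction m generalizing a with
  | zero =>
    intro j hj
    obtain rfl : j = 0 := Nat.le_zero.mp hj
    simpa using h
  | succ m ih =>
    -- split off the top digit `j = m + 1`
    rw [Finset.sum_range_succ, Nat.sub_self, pow_zero, mul_one] at h
    -- every earlier term is divisible by `τ`
    have hdvd : τ ∣ ∑ j ∈ Finset.range (m + 1), a j * τ ^ (m + 1 - j) :=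
      Finset.dvd_sum fun j hj => dvd_mul_of_dvd_right
        (dvd_pow_self τ (by have := Finset.mem_range.mp hj; omega)) _
    -- hence `τ ∣ a (m + 1)`, so the top digit vanishes by degrees
    have htop : a (m + 1) = 0 := by
      have hsum : τ ∣ ∑ j ∈ Finset.range (m + 1), a j * τ ^ (m + 1 - j) + a (m + 1) := by
        rw [h]; exact dvd_zero τ
      exact Polynomial.eq_zero_of_dvd_of_natDegree_lt ((dvd_add_right hdvd).mp hsum) (ha _)
    rw [htop, add_zero] at h
    -- factor `τ` out of the remaining sum and cancel it
    have key : ∑ j ∈ Finset.range (m + 1), a j * τ ^ (m + 1 - j) =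
        τ * ∑ j ∈ Finset.range (m + 1), a j * τ ^ (m - j) := by
      rw [Finset.mul_sum]
      refine Finset.sum_congr rfl fun j hj => ?_
      have hj' := Finset.mem_range.mp hj
      rw [show m + 1 - j = (m - j) + 1 by omega, pow_succ]
      ring
    rw [key] at h
    have h' : ∑ j ∈ Finset.range (m + 1), a j * τ ^ (m - j) = 0 :=
      (mul_eq_zero.mp h).resolve_left hτ0
    intro j hj
    rcases Nat.lt_or_eq_of_le hj with hlt | rfl
    · exact ih a ha h' j (by omega)
    · exact htop

end Summit.KontsevichZagierPeriods.InverseLandau.TateFamilyKernel.Descent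

end
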